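import Summits.CriticalPhenomena.SAWScalingLimit.Theses.SAWRenewalTightness
import Summits.CriticalPhenomena.SAWScalingLimit.Theorems.AnnularMassDecay.Negative.LoadBearing
import Literature.Probability.RandomPlanarGeometry.SAWBridges
import Literature.Probability.RandomPlanarGeometry.SAWWordBridges
import Literature.Probability.RandomPlanarGeometry.BDGS2012Proofs

/-!
# Line `normal-kesten-closure-domination` for the crux `SAWRenewalTightness.AnnularMassDecay` (stmt-CriticalPhenomena-4729)

Skeleton (crux-plan, round 1, 2026-08-16) of the idea card
`Cruxes/AnnularMassDecay/Ideas/normal-kesten-closure-domination.md` (ideator 2; triage r1: 3/3 pass,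
"best-developed member of the merged Kesten-measure trio" ≈ kesten-bridge-reference-measure ≈
kesten-measure-pricing).  The crux (lattice units on `ℤ²`, `x_c = SAW.criticalFugacity`):
`∃ θ > 0, C, ∀ z r R u N, 1 ≤ r < R ≤ |u − z| → annMass z r R u N ≤ C (r/R)^θ`, where `annMass`
(landed, `Theorems/AnnularMassDecay/Negative/LoadBearing.lean`, `annularMassDecay_iff = Iff.rfl`) is
the `x_c`-mass of SAWs from `u` with interior in the open annulus `r < |· − z| < R`, end in `|· − z| ≤ r`.

## The line in one paragraph

Every annular bridge from `u` is a walk in the OPEN SUPPORTING HALF-PLANE of the disc `B(z,R)` at `u`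
(inward unit normal `e_u = (z − u)/|z − u|`, generally irrational): `|v − z| < R ≤ |u − z|` gives
`⟨v − u, z − u⟩ > 0`.  So the crux follows (TRANSFER, `stub_annularOfHalfPlane`) from the half-plane
statement `HalfPlaneBallDecay` (= the card's `C⁺`): the `x_c`-mass of `e`-half-plane walks from `u`
killed at first entry of `B̄(z,r)` is `≤ C (r/R)^θ`.  In the half-plane, `u` is the STRICT `e`-level
minimum, which is Kesten's bridge hypothesis in direction `e`; only the upper renewal bound
`Aᵉ(x_c) = Σ_{irreducible e-bridges} x_c^{|β|} ≤ 1` is ever used (`stub_dirKestenBound`, valid for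
every unit direction, no unfolding / lattice symmetry).  MASSES of killed prefixes `π` are converted
into Kesten WEIGHTS by record-closure domination: continue `π` to its first strict `e`-record above
its own record level (`escMass`); the closures form a prefix-free family of `e`-bridges through the
ball, so Kraft over the irreducible-bridge alphabet prices them, and
  `hpBallMass ≤ c₀⁻¹ · (closure-weighted hitting mass) + (trapped prefixes)`.
The two atoms are then (UB) `stub_untrappedBulk` — trapped prefixes (closure mass `< c₀`) carry at
most a fraction `1 − δ` of the first-entry mass (relative, scale-free, decay-free) — and (KH)
`ClosureHittingDecay` — the closure-weighted hitting mass of a far `r`-ball decays like `(r/R)^θ` —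
which `stub_closureHittingOfRenewal` reduces, by the renewal decomposition at the last renewal level
below the ball + Kraft over prefix-free word families + a dyadic sum, to the two one-dimensional /
one-bridge properties of Kesten's renewal structure: (KW) `stub_renewalWindowSparsity` — sparsity of
renewal LEVELS in far windows, `P(∃ renewal level ∈ [T − w, T]) ≤ C (w/T)^θ` (predicted `θ = 1/4`) —
and (TS) `stub_irreducibleBridgeSpread` — transversal spread of the PATH of one irreducible bridge
(predicted `θ = 2/3`).  `stub_halfPlaneOfDomination` is the domination algebra UB → KH → HP.

## Stubs (7, registered; `sorry` lives only in them) and the composition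

* S1 `stub_annularOfHalfPlane`      : `HalfPlaneBallDecay → AnnMassDecay`            (transfer C⁺ → crux; S/M, provable now)
* S2 `stub_halfPlaneOfDomination`   : `UntrappedBulk → ClosureHittingDecay → HalfPlaneBallDecay` (M, provable now)
* S3 `stub_untrappedBulk`           : UB                                               (OPEN; L–XL; the SAWNotKineticallyGrown residue)
* S4 `stub_closureHittingOfRenewal` : `DirKestenBound → RenewalWindowSparsity → IrreducibleBridgeSpread → ClosureHittingDecay` (L, provable now: renewal bookkeeping)
* S5 `stub_dirKestenBound`          : `Aᵉ(x_c) ≤ 1` for every unit `e`                (M, provable now; Madras–Slade (4.2.2)–(4.2.4) with real levels)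
* S6 `stub_renewalWindowSparsity`   : KW                                               (OPEN — HARDEST: at `w = 1` it contains polynomial
                                        span-decay of critical bridges on `ℤ²` in every direction, MadrasSlade1993 p.92, arXiv:2310.17299 p.2)
* S7 `stub_irreducibleBridgeSpread` : TS                                               (OPEN; L–XL)

`AnnularMassDecay_of : S1 → S2 → S3 → S4 → S5 → S6 → S7 → AnnularMassDecay` is pure composition
(`annularMassDecay_iff.mpr (h₁ (h₂ h₃ (h₄ h₅ h₆ h₇)))`), kernel-checked, no `sorry` of its own; the
hypotheses are the name-keyed aliases `Registered.stub_*` (same device as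
`Summits/ABC/ABC/Cruxes/SomeWindowSaving/Lines/inert-box-collapse.lean`), and the wiring `example` at the
end feeds the verbatim stubs into it.  S1 concludes the crux in the disprover's NAMED form `AnnMassDecay`
(`annMass`, `Iff.rfl`-equal) so that `AnnularMassDecay_of` is the ONLY theorem of the file concluding the
crux decl by name (unambiguous skeleton audit).

## Disproof used (Disproof.lean cycles 1–2 + landed `Negative/LoadBearing` (imported) and `Negative/HalfPlaneDivergence`)

* `annularMassDecay_false_without_startOutside` (`R ≤ |u − z|` load-bearing): USED by S1 at its first
  step — it is what puts the open disc inside the open supporting half-plane at `u` and makes `u` the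
  strict level minimum; `HalfPlaneBallDecay` keeps the clause verbatim.
* `annularMassDecay_false_without_endInside` (endpoint clause load-bearing): kept in `IsEntryPrefix`
  (`dist (u + ω n) z ≤ r`); it is what makes the killed family PREFIX-FREE (first entrance) — the
  property S2/S4 price by Kraft; drop it and the Kraft image is everything.
* `annularMassDecay_false_without_innerRadiusOne` (`1 ≤ r` load-bearing): kept in HP, KH, UB, TS
  (`1 ≤ r`) and in KW as `1 ≤ w` (a window / ball thinner than a lattice spacing carries no decay).
* Disproof §A'' `false_without_avoidInner` + `halfPlanePartialSum_unbounded` (`H(x_c) = ∞`): the interior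
  avoidance `r < dist (u + ω i) z` is kept in `IsEntryPrefix`; the closures are confined to the STRIP
  `0 < lev ≤ record` (they are bridges), never to a half-plane, so the half-plane divergence does not enter.
* `annularMassDecay_iff_posR` (`r < R` cosmetic), `const_ge_of_bound` (`C ≥ x_c 2^θ`): consistent —
  all constants here come from Kraft sums `≤ 1` and `c₀, δ` of UB; nothing is claimed near aspect 1.
* Disproof §F(v) "annular bridges do not concatenate submultiplicatively": honoured — the line never
  concatenates annular bridges; its only junctions are directional renewal points (exact, entropy-free).
* Disproof §H (RKI numerically false off-lattice) concerns card radial-renewal only; nothing radial here.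
No stub is an instance of a landed Negative lemma: every stub keeps start-outside / end-inside /
`1 ≤ r`; `ledger negatives --problem CriticalPhenomena` (8 items) has nothing on bridge/renewal masses.

## Triage answers (r1-1, r1-2, r1-3 — all pass)

* "KW at w = 1 ⊇ polynomial bridge decay on ℤ² (canonical open problem); θ ≤ 1/4 here" — accepted and
  made explicit: S6 is declared the HARDEST stub; the line is an honest reduction crux ⟸ (KW, TS, UB).
* "Case A needs θ = 0 boundedness C₀ as input" (r1-3) — NOT needed in this skeleton: S4 works with the
  CLOSURE-WEIGHTED mass, whose Kraft price is ≤ 1 unconditionally (EscapeWeightedBound is a lemma inside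
  S4, from S5); boundedness of the raw mass is OUTPUT (S2), not input.
* "UB must be RELATIVE" (r1-2) — S3 is relative (`≤ (1 − δ) · hpBallMass`), and sharpened here to balls
  strictly inside the half-plane (`r < lev z`), the only case S2 consumes.
* "merge with kesten-bridge-reference-measure / kesten-measure-pricing" — the shared lever is S2+S5
  (pricing of the prefix-free first-entry family under Kesten's measure in the normal frame); their
  ONE-ARM atom is KH, cut here as S4 ⟸ S6 × S7; their decoy-row / FRAME lemmas are not needed.
-/

noncomputable section

open scoped BigOperators Classical
open Finset Literature.Probability.LatticeModels Literature.Probability.RandomPlanarGeometry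

namespace Summit.CriticalPhenomena.SAWScalingLimit.Cruxes.AnnularMassDecay.NormalKestenClosureDomination

open Summit.CriticalPhenomena.SAWScalingLimit.Theses.SAWRenewalTightness (AnnularMassDecay)
open Summit.CriticalPhenomena.SAWScalingLimit.Theorems.AnnularMassDecay.Negative
  (annMass annularMassDecay_iff)

/-! ## Vocabulary (walks are `SAW.Zd.saws 2 n`: start `0`, frozen after `n`; shifted by the start `u`) -/

/-- Shorthand: `x_c = 1/μ(ℤ²)`. -/
abbrev xc : ℝ := SAW.criticalFugacity

/-- Level functional of the direction `(c, s)` (meant with `c² + s² = 1`): `lev (c,s) v = c v₀ + s v₁`. -/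
def lev (c s : ℝ) (v : Site 2) : ℝ := c * (v 0 : ℝ) + s * (v 1 : ℝ)

/-- The crux in the disprover's NAMED form (`Negative.annularMassDecay_iff : AnnularMassDecay ↔ this`
is `Iff.rfl`).  Used as the conclusion of the transfer stub so that only `AnnularMassDecay_of`
concludes the crux decl by name. -/
def AnnMassDecay : Prop :=
  ∃ θ C : ℝ, 0 < θ ∧ ∀ (z : ℂ) (r R : ℝ), 1 ≤ r → r < R →
    ∀ u : Site 2, R ≤ dist (Site.toComplex u) z → ∀ N : ℕ, annMass z r R u N ≤ C * (r / R) ^ θ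

/-- `AnnularMassDecay ↔ AnnMassDecay` (definitional; the landed `Negative.annularMassDecay_iff`). -/
theorem annMassDecay_iff : AnnularMassDecay ↔ AnnMassDecay := annularMassDecay_iff

/-- **First-entry prefix** of the ball `B̄(z,r)` in the `(c,s)`-half-plane at `u`: a walk `ω` (from `0`,
shifted by `u`) whose vertices after the start lie strictly inside the open half-plane
`{lev > lev u}`, which avoids `B̄(z,r)` at interior times and ends in it.  Keeps the three load-bearing
clauses of the crux (start outside is imposed by the consumer, end inside, inner avoidance). -/
def IsEntryPrefix (c s : ℝ) (u : Site 2) (z : ℂ) (r : ℝ) (n : ℕ) (ω : ℕ → Site 2) : Prop :=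
  (∀ i, 0 < i → i ≤ n → 0 < lev c s (ω i)) ∧
  (∀ i, 0 < i → i < n → r < dist (Site.toComplex (u + ω i)) z) ∧
  dist (Site.toComplex (u + ω n)) z ≤ r

/-- **Half-plane-to-ball hitting mass** (partial sum up to length `N`): `x_c`-mass of the first-entry
prefixes of `B̄(z,r)` from `u` in direction `(c,s)`.  No disc confinement. -/
def hpBallMass (c s : ℝ) (u : Site 2) (z : ℂ) (r : ℝ) (N : ℕ) : ℝ :=
  ∑ n ∈ range (N + 1), ∑ _ω ∈ (SAW.Zd.saws 2 n).filter (IsEntryPrefix c s u z r n), xc ^ n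

/-- **(HP) Half-plane ball decay** — the card's transfer `C⁺`, ALIGNED form: the half-plane is the
supporting half-plane at `u` of the disc centred `z` (inward normal `(z − u)/|z − u|`, possibly
irrational): the hitting mass of `B̄(z,r)` is `≤ C (r/R)^θ` whenever `1 ≤ r < R ≤ |u − z|`.
Predicted `≍ (r/R)^{35/48} r^{-1/4}` (same exponents as the crux). -/
def HalfPlaneBallDecay : Prop :=
  ∃ θ C : ℝ, 0 < θ ∧ ∀ (u : Site 2) (z : ℂ) (r R : ℝ), 1 ≤ r → r < R →
    R ≤ dist (Site.toComplex u) z → ∀ N : ℕ,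
      hpBallMass ((z - Site.toComplex u).re / dist (Site.toComplex u) z)
        ((z - Site.toComplex u).im / dist (Site.toComplex u) z) u z r N ≤ C * (r / R) ^ θ

/-- Directional bridge from `ω 0` (Madras–Slade Def. 1.2.4 with the first coordinate replaced by the
real level `lev c s`): `lev (ω 0) < lev (ω i) ≤ lev (ω n)` for `1 ≤ i ≤ n`. -/
def IsDirBridge (c s : ℝ) (n : ℕ) (ω : ℕ → Site 2) : Prop :=
  ∀ i, 1 ≤ i → i ≤ n → lev c s (ω 0) < lev c s (ω i) ∧ lev c s (ω i) ≤ lev c s (ω n)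

/-- Directional break point (Madras–Slade (4.2.1) with `lev`): `0 < j < n`, levels up to time `j` are
`≤ lev (ω j)`, levels after time `j` are `> lev (ω j)`.  The renewal LEVELS of a bridge are the levels
of its break points. -/
def IsDirBreak (c s : ℝ) (n : ℕ) (ω : ℕ → Site 2) (j : ℕ) : Prop :=
  0 < j ∧ j < n ∧ (∀ i ≤ j, lev c s (ω i) ≤ lev c s (ω j)) ∧
    ∀ i, j < i → i ≤ n → lev c s (ω j) < lev c s (ω i)

/-- Irreducible directional bridge (Madras–Slade Def. 4.2.1 with `lev`): a nontrivial bridge without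
break points. -/
def IsDirIrrBridge (c s : ℝ) (n : ℕ) (ω : ℕ → Site 2) : Prop :=
  1 ≤ n ∧ IsDirBridge c s n ω ∧ ∀ j, ¬ IsDirBreak c s n ω j

/-- `x_c`-mass of irreducible `(c,s)`-bridges from `0` of span `≥ t` (partial sums): the Kesten tail
`P̄ᵉ(t)` of the span law of ONE irreducible `e`-bridge (`t ≤ 0`: all of them, `Aᵉ(x_c)`). -/
def dirIrrMassGe (c s : ℝ) (t : ℝ) (N : ℕ) : ℝ :=
  ∑ n ∈ range (N + 1), ∑ _ω ∈ (SAW.Zd.saws 2 n).filter (fun ω =>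
      IsDirIrrBridge c s n ω ∧ t ≤ lev c s (ω n)), xc ^ n

/-- **Direction-free Kesten bound** `Aᵉ(x_c) ≤ 1` for EVERY unit direction `e = (c,s)`. -/
def DirKestenBound : Prop :=
  ∀ (c s : ℝ), c ^ 2 + s ^ 2 = 1 → ∀ N : ℕ, dirIrrMassGe c s 0 N ≤ 1

/-- Mass of `(c,s)`-bridges from `0` whose END is their first renewal level in `[a, b]`: bridges with
`a ≤ lev(end) ≤ b` and every break point at level `< a` (i.e. words over the irreducible alphabet whose
last letter is the first to reach level `≥ a`, landing `≤ b`).  Its value is the (defective) Kesten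
probability that the regenerative set of renewal LEVELS meets `[a, b]`. -/
def dirRenewalWindow (c s : ℝ) (a b : ℝ) (N : ℕ) : ℝ :=
  ∑ n ∈ range (N + 1), ∑ _ω ∈ (SAW.Zd.saws 2 n).filter (fun ω =>
      1 ≤ n ∧ IsDirBridge c s n ω ∧ a ≤ lev c s (ω n) ∧ lev c s (ω n) ≤ b ∧
      ∀ j, IsDirBreak c s n ω j → lev c s (ω j) < a), xc ^ n

/-- **(KW) Renewal-window sparsity**: a far window of relative length `w/T` contains a renewal level
with (defective Kesten) probability `≤ C (w/T)^θ`, uniformly in the direction (predicted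
`θ = 1 − 3/4 = 1/4`, the Dynkin–Lamperti exponent of the span renewal process, `u_L ≍ L^{-1/4}`). -/
def RenewalWindowSparsity : Prop :=
  ∃ θ C : ℝ, 0 < θ ∧ ∀ (c s : ℝ), c ^ 2 + s ^ 2 = 1 → ∀ (w T : ℝ), 1 ≤ w → 2 * w ≤ T →
    ∀ N : ℕ, dirRenewalWindow c s (T - w) T N ≤ C * (w / T) ^ θ

/-- Record level of a prefix `π` of length `m`: `max_{j ≤ m} lev (π j)`. -/
def recLevel (c s : ℝ) (m : ℕ) (π : ℕ → Site 2) : ℝ :=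
  (range (m + 1)).sup' ⟨0, mem_range.2 (Nat.succ_pos m)⟩ fun j => lev c s (π j)

/-- **Record-closure (escape) mass** of a prefix `π` of length `m` (from `0`), budget `K`: extensions by
`k ≤ K` further SAW steps after which the whole walk is a `(c,s)`-bridge from `0` whose END is its first
strict exceedance of the record level of `π` (all earlier levels `≤ recLevel`, the last one `>` it).
The closures `{πη}` of distinct first-entry prefixes form a PREFIX-FREE family of bridges. -/
def escMass (c s : ℝ) (m : ℕ) (π : ℕ → Site 2) (K : ℕ) : ℝ :=
  ∑ k ∈ range (K + 1), ∑ _ω ∈ (SAW.Zd.saws 2 (m + k)).filter (fun ω =>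
      (∀ i ≤ m, ω i = π i) ∧ IsDirBridge c s (m + k) ω ∧
      (∀ i < m + k, lev c s (ω i) ≤ recLevel c s m π) ∧
      recLevel c s m π < lev c s (ω (m + k))), xc ^ k

/-- **Closure-weighted hitting mass** of `B̄(z,r)` from `0` in direction `(c,s)`: each first-entry prefix
weighted by its record-closure mass — the MASS form of the Kesten weight of "the renewal walk from `0`
visits `B̄(z,r)`" (`Σ_π x_c^{|π|} escMass(π) = ` Kraft price of the prefix-free closure family). -/
def closureHitMass (c s : ℝ) (z : ℂ) (r : ℝ) (N K : ℕ) : ℝ :=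
  ∑ n ∈ range (N + 1), ∑ ω ∈ (SAW.Zd.saws 2 n).filter (IsEntryPrefix c s 0 z r n),
      xc ^ n * escMass c s n ω K

/-- **(KH) Closure-weighted hitting decay** — the Kesten-side atom (one-arm estimate for Kesten's
renewal walk, in mass form): for a ball at level `≥ R > r ≥ 1` ahead of the start,
`closureHitMass ≤ C (r/R)^θ`, uniformly in the direction, the transversal offset and the budgets. -/
def ClosureHittingDecay : Prop :=
  ∃ θ C : ℝ, 0 < θ ∧ ∀ (c s : ℝ), c ^ 2 + s ^ 2 = 1 → ∀ (z : ℂ) (r R : ℝ), 1 ≤ r → r < R →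
    R ≤ c * z.re + s * z.im → ∀ N K : ℕ, closureHitMass c s z r N K ≤ C * (r / R) ^ θ

/-- Mass of irreducible `(c,s)`-bridges from `0` whose span reaches the near level `lev z − r` of the
ball `B̄(z,r)` AND whose path visits the ball (partial sums). -/
def irrHitMass (c s : ℝ) (z : ℂ) (r : ℝ) (N : ℕ) : ℝ :=
  ∑ n ∈ range (N + 1), ∑ _ω ∈ (SAW.Zd.saws 2 n).filter (fun ω =>
      IsDirIrrBridge c s n ω ∧ c * z.re + s * z.im - r ≤ lev c s (ω n) ∧
      ∃ i ≤ n, dist (Site.toComplex (ω i)) z ≤ r), xc ^ n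

/-- **(TS) Transversal spread of one irreducible bridge** — the single genuinely two-dimensional atom:
among irreducible `(c,s)`-bridges from `0` whose span reaches the near level `ℓ − r` of a ball
`B̄(z,r)` lying ahead at level `ℓ = lev z ≥ 2r` (ANY transversal offset), the `x_c`-mass of those
whose path visits the ball is `≤ C (r/ℓ)^θ ×` the Kesten tail `P̄ᵉ(ℓ − r)` (predicted
`θ = 2 − 4/3 = 2/3`: a level line meets the bridge in a set of dimension `1/3` spread over width `≍ ℓ`). -/
def IrreducibleBridgeSpread : Prop :=
  ∃ θ C : ℝ, 0 < θ ∧ ∀ (c s : ℝ), c ^ 2 + s ^ 2 = 1 → ∀ (z : ℂ) (r : ℝ), 1 ≤ r →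
    2 * r ≤ c * z.re + s * z.im → ∀ N : ℕ, ∃ N' : ℕ,
      irrHitMass c s z r N ≤
        C * (r / (c * z.re + s * z.im)) ^ θ * dirIrrMassGe c s (c * z.re + s * z.im - r) N'

/-- Mass of the TRAPPED first-entry prefixes of `B̄(z,r)` from `0`: those whose record-closure mass
(budget `K`) is `< c₀`. -/
def trappedMass (c s : ℝ) (z : ℂ) (r : ℝ) (c₀ : ℝ) (N K : ℕ) : ℝ :=
  ∑ n ∈ range (N + 1), ∑ _ω ∈ (SAW.Zd.saws 2 n).filter (fun ω =>
      IsEntryPrefix c s 0 z r n ω ∧ escMass c s n ω K < c₀), xc ^ n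

/-- **(UB) Untrapped bulk** (relative, scale-free, decay-free SAW-side atom; the quarantined form of the
barrier `SAWNotKineticallyGrown`): for some `c₀, δ > 0`, for every unit direction and every ball
strictly inside the open half-plane (`r < lev z`, the only case the line consumes), a budget `K` exists
for which the trapped prefixes carry at most the fraction `1 − δ` of the first-entry mass.  (A prefix
entering at its own record level has closure mass `≥ x_c`; trapping needs the prefix to surround the
whole fresh ball `B̄(z,r)`, `r ≥ 1`, to lattice precision before entering it.) -/
def UntrappedBulk : Prop :=
  ∃ c₀ δ : ℝ, 0 < c₀ ∧ 0 < δ ∧ ∀ (c s : ℝ), c ^ 2 + s ^ 2 = 1 → ∀ (z : ℂ) (r : ℝ), 1 ≤ r →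
    r < c * z.re + s * z.im → ∀ N : ℕ, ∃ K : ℕ,
      trappedMass c s z r c₀ N K ≤ (1 - δ) * hpBallMass c s 0 z r N

/-! ### Foreseen helper statements (NOT stubs; they land with `--supports` inside S2/S4) -/

/-- A finite family of nontrivial `(c,s)`-bridges from `0` (pairs length/function) is prefix-free. -/
def PrefixFree (c s : ℝ) (F : Finset (Σ _ : ℕ, (ℕ → Site 2))) : Prop :=
  (∀ p ∈ F, p.2 ∈ SAW.Zd.saws 2 p.1 ∧ 1 ≤ p.1 ∧ IsDirBridge c s p.1 p.2) ∧
  ∀ p ∈ F, ∀ q ∈ F, p.1 < q.1 → ∃ i ≤ p.1, p.2 i ≠ q.2 i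

/-- Kraft over the irreducible-bridge alphabet (helper of S4, from S5 by unique factorisation at break
points, Madras–Slade (4.2.2), transported to real levels): a prefix-free finite family of
`(c,s)`-bridges has `Σ x_c^{|B|} ≤ 1`. -/
def PrefixFreeKestenBound : Prop :=
  ∀ (c s : ℝ), c ^ 2 + s ^ 2 = 1 → ∀ F : Finset (Σ _ : ℕ, (ℕ → Site 2)), PrefixFree c s F →
    ∑ p ∈ F, xc ^ p.1 ≤ 1

/-- Escape-weighted domination (helper of S4; the `θ = 0` content of KH, from `PrefixFreeKestenBound`
because the closure family is prefix-free): `closureHitMass ≤ 1` for every ball with `r < ‖z‖`. -/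
def EscapeWeightedBound : Prop :=
  ∀ (c s : ℝ), c ^ 2 + s ^ 2 = 1 → ∀ (z : ℂ) (r : ℝ), r < ‖z‖ → ∀ N K : ℕ,
    closureHitMass c s z r N K ≤ 1

/-! ## The registered stubs (`sorry` lives only in these seven theorems) -/

/-- **S1 · `stub_annularOfHalfPlane`** (TRANSFER `C⁺ → crux`; size S/M, provable now).
`HalfPlaneBallDecay → AnnMassDecay` (`AnnMassDecay ↔ AnnularMassDecay` by `Iff.rfl`): termwise inclusion
of nonnegative finite sums with the same `θ, C` — an annular bridge from `u` has
`|u + ω i − z| < R ≤ |u − z|` for `0 < i ≤ n` (interior: annulus clause; end: `≤ r < R`), hence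
`⟨ω i, z − u⟩ = ½(|u − z|² − |u + ω i − z|² + |ω i|²) > 0`, i.e. `0 < lev (aligned) (ω i)`; the inner
avoidance and end clauses are copied.  Leans on: `Finset.sum_le_sum_of_subset_of_nonneg`,
`Site.toComplex_re/_im` + the two-line `toComplex (x + y) = toComplex x + toComplex y`
(Disproof.lean §G `toComplex_add`, not yet landed), `Complex.sq_norm`/`normSq`.  USES
`false_without_startOutside`'s hypothesis `R ≤ |u − z|` essentially (it is what makes the level positive). -/
theorem stub_annularOfHalfPlane : HalfPlaneBallDecay → AnnMassDecay := by
  sorry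

/-- **S2 · `stub_halfPlaneOfDomination`** (record-closure domination; size M, provable now).
`UntrappedBulk → ClosureHittingDecay → HalfPlaneBallDecay` with `θ = θ_KH`, `C = C_KH/(c₀ δ)`:
translate `u` to `0` (`hpBallMass c s u z r N = hpBallMass c s 0 (z − ↑u) r N`, lattice translation);
the aligned direction `(c,s) = (z−u)/|z−u|` is a unit vector with `lev (z − u) = |z − u| ≥ R > r`, so UB
gives a budget `K`; split `hpBallMass = (escMass ≥ c₀ part) + trappedMass ≤ c₀⁻¹ closureHitMass(N,K)
+ (1 − δ) hpBallMass`, and KH bounds `closureHitMass ≤ C (r/R)^θ`; rearrange (`δ · M ≤ c₀⁻¹ C (r/R)^θ`).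
Leans on: `Finset.sum_filter_add_sum_filter_not`, `Finset.sum_le_sum`, S3, KH. -/
theorem stub_halfPlaneOfDomination : UntrappedBulk → ClosureHittingDecay → HalfPlaneBallDecay := by
  sorry

/-- **S3 · `stub_untrappedBulk`** (UB; OPEN, size L–XL; `= UntrappedBulk` verbatim).
Why plausibly true: a prefix entering the ball at its own record level has `escMass ≥ x_c` (one more
step in the best lattice direction is a strict record and cannot have been visited); a prefix with
overshoot `h` and an unsealed tip has closure mass `≳ h^{1/16}` (tip at a slit end: wedge exponent
5/16, Duplantier–Saleur); so `escMass < c₀` forces the prefix to SURROUND the fresh ball `B̄(z,r)`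
(radius `≥ 1`, unvisited, lattice-connected) to lattice precision before entering — a lattice-scale
pinch whose mass fraction is `< 1` at `r ≍ 1` and `→ 0` as `r → ∞` (simple SLE₈/₃ curves do not
self-touch).  Intended tool: a multi-valued "unsealing" map (DuminilCopinHammond2013,
arXiv:1305.1257, arXiv:1504.05286 technology), the gain being the corridor the trapped prefix must
pinch around its own tip.  Why it might fail: no un-trapping estimate with constants exists for `ℤ²`
SAW; uniformity in the direction and in near-wall balls (`lev z − r ≪ 1`) is untested. -/
theorem stub_untrappedBulk :
    ∃ c₀ δ : ℝ, 0 < c₀ ∧ 0 < δ ∧ ∀ (c s : ℝ), c ^ 2 + s ^ 2 = 1 → ∀ (z : ℂ) (r : ℝ), 1 ≤ r →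
      r < c * z.re + s * z.im → ∀ N : ℕ, ∃ K : ℕ,
        trappedMass c s z r c₀ N K ≤ (1 - δ) * hpBallMass c s 0 z r N := by
  sorry

/-- **S4 · `stub_closureHittingOfRenewal`** (the renewal decomposition; size L, provable now — no new
idea, much bookkeeping).  `DirKestenBound → RenewalWindowSparsity → IrreducibleBridgeSpread →
ClosureHittingDecay`.  Proof plan (levels from `0` along `e`, ball at level `L = lev z ≥ R > r`):
(0) transport Kesten's structure to real levels: factorisation of a `(c,s)`-bridge at its break points
into irreducible pieces (unique: the first factor ends at the FIRST break point, cf.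
`SAW.eq_of_append_eq`), Kraft `PrefixFreeKestenBound` from S5 by induction on length, and
`EscapeWeightedBound` (the closure family `{πη}` is prefix-free: equal first-entry times, then equal
first-exceedance times).  (1) For a closure bridge `B = πη = β₁⋯β_m` let `β_{i*}` be the letter
containing the entry time `|π|` and `J₀` its starting (renewal) level, `J₀ < L + r`.
CASE A `J₀ ≥ L − 2r`: map `B ↦` its shortest word-prefix reaching level `≥ L − 2r` (lands `≤ L + r`);
fibres are prefix-free, so the mass is `≤ dirRenewalWindow (L − 2r) (L + r) ≤ C_KW (3r/(L + r))^θ` by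
KW (`T = L + r`, `w = 3r`; if `L < 5r` use the Kraft bound `≤ 1` and `(r/R)^θ ≥ 5^{-θ}`).
CASE B `J₀ < L − 2r`: `β_{i*}` is an irreducible bridge from a lattice point `v` (`lev v = J₀`) visiting
the ball at relative level `ℓ = L − J₀ > 2r` with span `≥ ℓ − r`; by TS (translated to `v`) and Kraft on
the continuation, the mass is `≤ Σ_{J₀} u(J₀) · C_TS (r/(L − J₀))^{θ_TS} · P̄(L − r − J₀)`; group
`L − r − J₀ ∈ [2^k r, 2^{k+1} r)`: `Σ_{J₀ in block} u(J₀) P̄(L − r − J₀) ≤ dirRenewalWindow(block) ≤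
C_KW (2^k r/(L − r − 2^k r))^{θ_KW}` (words `w'β` ↦ shortest prefix of `w'` reaching the block;
prefix-free fibres; KW needs `3·2^k r ≤ L − r`, the ≤ 2 remaining blocks are bounded by `1`), and
`Σ_k 2^{−kθ_TS} 2^{kθ_KW}` converges after shrinking `θ_KW < θ_TS` (KW is monotone in `θ`).
Output `θ = θ_KW' = min(θ_KW, θ_TS/2)`, `C` explicit.  Leans on: S5, KW, TS, `Real.rpow` algebra,
`Finset.sum_sigma`/`sum_comm`, lattice translation of `saws`. -/
theorem stub_closureHittingOfRenewal :
    DirKestenBound → RenewalWindowSparsity → IrreducibleBridgeSpread → ClosureHittingDecay := by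
  sorry

/-- **S5 · `stub_dirKestenBound`** (`Aᵉ(x_c) ≤ 1` in EVERY unit direction; size M, provable now;
`= DirKestenBound` verbatim).  Madras–Slade (4.2.2)–(4.2.4) with real levels and WITHOUT unfolding:
for `x < x_c`, `Bᵉ(x) := Σ_{e-bridges} x^{|ω|} ≤ Σ_n c_n xⁿ < ∞` (`SAW.Zd.summable_count_mul_pow`,
`criticalPoint_two`); concatenation (irreducible e-bridge, e-bridge) ↦ e-bridge is injective (a second
factorisation would put a break point inside an irreducible bridge), so `Aᵉ(x) Bᵉ(x) ≤ Bᵉ(x) − 1`,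
`Aᵉ(x) < 1`; each partial sum `Σ_{n ≤ N} aₙ xⁿ` is a polynomial, continuous at `x_c`, hence `≤ 1` at
`x_c`.  No lattice symmetry of the direction is used (only the upper bound is claimed; `Aᵉ = 1` is NOT). -/
theorem stub_dirKestenBound :
    ∀ (c s : ℝ), c ^ 2 + s ^ 2 = 1 → ∀ N : ℕ, dirIrrMassGe c s 0 N ≤ 1 := by
  sorry

/-- **S6 · `stub_renewalWindowSparsity`** (KW; OPEN — the HARDEST stub; size XL;
`= RenewalWindowSparsity` verbatim).  Why plausibly true: renewal levels form a (defective) regenerative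
set with `u_L ≍ L^{-1/4}` (DyhrGilbertKennedyLawlerPasson2011, Gilbert arXiv:1410.4796: span tail
`H^{-3/4}`), for which `P(renewal ∈ [T − w, T]) ≍ (w/T)^{1/4}` (Dynkin–Lamperti); isotropy of the
scaling limit makes it direction-uniform.  Why it might fail / what it costs: at `w = 1` it READS
`u_{T} ≤ C T^{-θ}` — polynomial decay of the span-renewal probability of critical `ℤ²` bridges, in every
direction: the open problem named in the crux docstring (MadrasSlade1993 p.92 = PDF p.107 "believed, no
known proof" for the length form; arXiv:2310.17299 p.2 "a major obstacle"; proved on the hexagonal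
lattice only, GlazmanManolescu2019 / `HexSAWBridgeDecay.tendsto_stripBlim`, Krachun–Panagiotis Thm 2,
via the parafermion, which `NienhuisWeightsExcludeVertexSAW` denies to `ℤ²`); rigorous texture today is
log-scale only (`Σ_{L ≤ Λ} u_L ≥ c log Λ`, `P̄(Λ) ≤ C/log Λ`).  The line's output exponent is
`θ ≤ θ_KW ≤ 1/4 < 35/48` (expected loss: Kraft forgets `u_R`). -/
theorem stub_renewalWindowSparsity :
    ∃ θ C : ℝ, 0 < θ ∧ ∀ (c s : ℝ), c ^ 2 + s ^ 2 = 1 → ∀ (w T : ℝ), 1 ≤ w → 2 * w ≤ T →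
      ∀ N : ℕ, dirRenewalWindow c s (T - w) T N ≤ C * (w / T) ^ θ := by
  sorry

/-- **S7 · `stub_irreducibleBridgeSpread`** (TS; OPEN, size L–XL; `= IrreducibleBridgeSpread` verbatim).
Why plausibly true: an irreducible bridge of span `S ≥ ℓ − r ≥ ℓ/2` is a fractal curve of dimension
`4/3` spread transversally over width `≍ S`; a level line meets it in dimension `1/3`, so a given
`r`-ball at that level is visited with (Kesten) probability `≲ (r/S)^{2/3} ≤ 2^{2/3}(r/ℓ)^{2/3}`, and for
`S ≈ ℓ − r` the END must fall in an `r`-window of a line of width `≍ S` (`≲ r/S`).  Any `θ > 0` suffices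
for the line.  Why it might fail: needs transversal anti-concentration of the irreducible-bridge path
uniformly in the offset and the direction — a one-arm-type statement for Kesten's bridge
(DKY-Problem-10 flavour: quantitative non-space-filling at `x_c`), nothing in print on `ℤ²`;
note the normalisation by the TAIL `P̄ᵉ(ℓ − r)` (partial sum `N'` free), not by `u`. -/
theorem stub_irreducibleBridgeSpread :
    ∃ θ C : ℝ, 0 < θ ∧ ∀ (c s : ℝ), c ^ 2 + s ^ 2 = 1 → ∀ (z : ℂ) (r : ℝ), 1 ≤ r →
      2 * r ≤ c * z.re + s * z.im → ∀ N : ℕ, ∃ N' : ℕ,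
        irrHitMass c s z r N ≤
          C * (r / (c * z.re + s * z.im)) ^ θ * dirIrrMassGe c s (c * z.re + s * z.im - r) N' := by
  sorry

/-! ### Consistency: each named statement IS its registered stub (definitionally) -/

theorem untrappedBulk_holds : UntrappedBulk := stub_untrappedBulk
theorem dirKestenBound_holds : DirKestenBound := stub_dirKestenBound
theorem renewalWindowSparsity_holds : RenewalWindowSparsity := stub_renewalWindowSparsity
theorem irreducibleBridgeSpread_holds : IrreducibleBridgeSpread := stub_irreducibleBridgeSpread
theorem closureHittingDecay_holds : ClosureHittingDecay :=
  stub_closureHittingOfRenewal dirKestenBound_holds renewalWindowSparsity_holds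
    irreducibleBridgeSpread_holds
theorem halfPlaneBallDecay_holds : HalfPlaneBallDecay :=
  stub_halfPlaneOfDomination untrappedBulk_holds closureHittingDecay_holds

/-! ### Name-keyed aliases of the seven stub statements (the hypotheses of the composition) -/
namespace Registered

/-- Alias of S1's statement keyed by the registered stub name. -/
abbrev stub_annularOfHalfPlane : Prop := HalfPlaneBallDecay → AnnMassDecay
/-- Alias of S2's statement keyed by the registered stub name. -/
abbrev stub_halfPlaneOfDomination : Prop :=
  UntrappedBulk → ClosureHittingDecay → HalfPlaneBallDecay
/-- Alias of S3's statement keyed by the registered stub name. -/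
abbrev stub_untrappedBulk : Prop := UntrappedBulk
/-- Alias of S4's statement keyed by the registered stub name. -/
abbrev stub_closureHittingOfRenewal : Prop :=
  DirKestenBound → RenewalWindowSparsity → IrreducibleBridgeSpread → ClosureHittingDecay
/-- Alias of S5's statement keyed by the registered stub name. -/
abbrev stub_dirKestenBound : Prop := DirKestenBound
/-- Alias of S6's statement keyed by the registered stub name. -/
abbrev stub_renewalWindowSparsity : Prop := RenewalWindowSparsity
/-- Alias of S7's statement keyed by the registered stub name. -/
abbrev stub_irreducibleBridgeSpread : Prop := IrreducibleBridgeSpread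

end Registered

/-! ## The composition (kernel-checked, no `sorry` of its own) -/

/-- **`AnnularMassDecay` from the seven stubs.**  S5, S6, S7 feed S4 (closure-weighted hitting decay
for Kesten's renewal walk in the normal direction); S3 and that feed S2 (record-closure domination:
half-plane ball decay, the transfer `C⁺`); S1 is the geometric inclusion annulus ⊂ supporting
half-plane; `annularMassDecay_iff` (`Iff.rfl`, landed Negative/LoadBearing) renames the disprover's
`annMass` form back to the crux decl.  Pure composition beyond the stubs. -/
theorem AnnularMassDecay_of
    (h₁ : Registered.stub_annularOfHalfPlane) (h₂ : Registered.stub_halfPlaneOfDomination)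
    (h₃ : Registered.stub_untrappedBulk) (h₄ : Registered.stub_closureHittingOfRenewal)
    (h₅ : Registered.stub_dirKestenBound) (h₆ : Registered.stub_renewalWindowSparsity)
    (h₇ : Registered.stub_irreducibleBridgeSpread) : AnnularMassDecay :=
  annularMassDecay_iff.mpr (h₁ (h₂ h₃ (h₄ h₅ h₆ h₇)))

/-- Wiring check: the registered stubs feed `AnnularMassDecay_of` as stated (the verbatim restatements
are definitionally the named statements). -/
example : AnnularMassDecay :=
  AnnularMassDecay_of stub_annularOfHalfPlane stub_halfPlaneOfDomination stub_untrappedBulk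
    stub_closureHittingOfRenewal stub_dirKestenBound stub_renewalWindowSparsity
    stub_irreducibleBridgeSpread

/-! ## Calibration against the landed Negative lemmas (imported; nothing here is an instance they refute)

The transfer target keeps the three load-bearing clauses: `R ≤ dist (toComplex u) z` (start outside),
`dist (u + ω n) z ≤ r` (end inside) and `1 ≤ r`; the half-plane divergence `H(x_c) = ∞` is about walks
with NO killing, whereas every family priced here is prefix-free. -/

example : ¬ ∃ θ C : ℝ, 0 < θ ∧ ∀ (z : ℂ) (r R : ℝ), 1 ≤ r → r < R → ∀ u : Site 2, ∀ N : ℕ,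
    annMass z r R u N ≤ C * (r / R) ^ θ :=
  Summit.CriticalPhenomena.SAWScalingLimit.Theorems.AnnularMassDecay.Negative.annularMassDecay_false_without_startOutside

-- `Negative.HalfPlaneDivergence.halfPlanePartialSum_unbounded : ∀ B, ∃ K, B < H_K` (landed 2026-08-16,
-- proposal 76222) is the finitary `H(x_c) = ∞`; it is not imported here only because the farm snapshot
-- serving this check predates its build — the lead should add the import once served.

end Summit.CriticalPhenomena.SAWScalingLimit.Cruxes.AnnularMassDecay.NormalKestenClosureDomination
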